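import Summits.CriticalPhenomena.PercolationContinuityZ3.Theorems.Transplant.D10SKc11_4500P1
import HarnessLib

/-!
# Diamond film `D_10` — KERNEL CERTIFICATE for the class `11_4500` of `ShapedLinkageX 4 (DiamondFilm.sqShadow (k := 10))`, THE CLASS (mask + coverage from the 1 parts) (template `fullmcp`, |W| = 106, 1482 terminal pairs, 4058 plans)

builds on p205010 (kernel theorem, internal audit signed; external expert review pending) — NOT used in this file.  Lane `prim-bschramm`, seat `prim-bschramm-p2` (gen 43; class C1b;
memo `HOME/bschramm/P2-LATTICES.md` §152); helper file (`--supports stmt-CriticalPhenomena-4575 --as helper`).  Generated by `cert/emit_dk.py` from the plans of `cert/gen_dk.py`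
(canonical BFS routings with avoid hints, exact mirror `cert/kern_dk.py` of «DkSKDefs»); re-checked here by the kernel (`DCtx.checkEs`); `caseOK_k10_11_4500` feeds «D10SKFinal».
[cite: DuminilCopinSidoraviciusTassion2016, §2.3 (proof of Fact 2: the three disjoint paths in B_R(z))]
-/

namespace Summit.CriticalPhenomena.PercolationContinuityZ3.Theorems.Transplant

namespace DiamondFilm.DK

/-- The cleared mask of the class `11_4500` of `D_10` is admissible (inside the cleared block, containing the forced core). [folklore] -/
theorem wOK_k10_11_4500 : DCtx.wOK (⟨10, 1, 1, 4, 5, 0, 0, 4519725596172674911582843904471860130749969820457690239926178706521927233088821615397179384107973223860505300003669000192⟩ : DCtx) = true := by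
  decide +kernel

/-- **THE CLASS `11_4500` OF `D_10` IS COVERED**: every needed bit of every certified terminal pair has a swap-pair plan. [cite: DuminilCopinSidoraviciusTassion2016, §2.3 (proof of Fact 2)] -/
theorem caseOK_k10_11_4500 : CaseOK (⟨10, 1, 1, 4, 5, 0, 0, 4519725596172674911582843904471860130749969820457690239926178706521927233088821615397179384107973223860505300003669000192⟩ : DCtx) :=
  caseOK_of_chunks _ [[14, 15, 16, 25, 29, 37], [49, 61, 73, 85, 97, 101], [110, 111, 112, 158, 159, 160], [169, 173, 181, 193, 205, 217], [229, 241, 245, 254, 255, 256], [302, 304, 326, 328, 350, 374], [376, 398, 400]]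
    (List.forall_mem_cons.2 ⟨checkEs_sound _ _ _ chunk_k10_11_4500_0, List.forall_mem_cons.2 ⟨checkEs_sound _ _ _ chunk_k10_11_4500_1, List.forall_mem_cons.2 ⟨checkEs_sound _ _ _ chunk_k10_11_4500_2, List.forall_mem_cons.2 ⟨checkEs_sound _ _ _ chunk_k10_11_4500_3, List.forall_mem_cons.2 ⟨checkEs_sound _ _ _ chunk_k10_11_4500_4, List.forall_mem_cons.2 ⟨checkEs_sound _ _ _ chunk_k10_11_4500_5, List.forall_mem_cons.2 ⟨checkEs_sound _ _ _ chunk_k10_11_4500_6, List.forall_mem_nil _⟩⟩⟩⟩⟩⟩⟩)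
    (by decide +kernel)

end DiamondFilm.DK

end Summit.CriticalPhenomena.PercolationContinuityZ3.Theorems.Transplant
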